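import Literature.NumberTheory.EllipticCurves.Rank1Residual.Typed.PAdicCertificateMultiplicativeCanonical
import Literature.NumberTheory.EllipticCurves.Rank1Residual.Typed.PAdicCertificateReducibleMultiplicativeCanonical
import Literature.NumberTheory.EllipticCurves.SteinWuthrich2013.MultiplicativeHeightExistence
import HarnessLib

/-!
# X11 / X2 at a multiplicative prime: the certificate theorems with the height datum SUPPLIED by the
# existence fact (cell `b2b-bsdres`, literature seat gen 6)

HONEST FRAMING (run/shared/lean/b2b/bsd-rank1-residual/, verbatim): the goal of the cell is to
DELETE the COMBINATION-SHAPED residual classes for ALL analytic-rank `≤ 1` elliptic curves over `ℚ`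
— "full BSD formula for every rank `≤ 1` curve in class C" assembled STRICTLY from published
theorems — so that the rank-`≤ 1` remainder becomes exactly the CONSTRUCTION-SHAPED classes, which
are TYPED (missing-input `Prop`s), NOT attempted. This is not "finishing BSD". X11's rank-one
`p ‖ N` part and X2 stay as booked by the referee (per-curve certificate routes; no label changes
here).

Theorems only (no definition, no new named fact). Companion of
`Typed/PAdicCertificateMultiplicativeCanonical.lean` (x11a gen 7, p181868) and
`Typed/PAdicCertificateReducibleMultiplicativeCanonical.lean` (p181917): there every certificate
theorem binds a height datum `(Dh : PAdicHeightData W p) (hDh : IsSplitMultCanonical Dh Dq)` (resp.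
`IsMultCanonical Dh q`) and a computed claim `hcert` about `padicRegulator Dh`. Applying such a
theorem to a curve requires a datum to EXIST — not a finite computation but the published existence
of Schneider's `p`-adic height = the Stein–Wuthrich §4.2 height (named facts
`SteinWuthrich2013.exists_isSplitMultCanonical` / `exists_isMultCanonical`,
`SteinWuthrich2013/MultiplicativeHeightExistence.lean`, literature seat gen 6; the multiplicative
analogue of `WeierstrassCurve.exists_isCanonical` used by the X1 engine). This file records the
resulting forms whose inputs are exactly: PUBLISHED named facts (`hA`/`hK`/`h16` divisibility, `hJ`
leading term, `hH` height existence, `hW`, `hGZK`, `hmod`, `h𝓛`), the class predicate, bookkeeping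
data of the divisibility fact (`κ, γ, f, D, ϖ, L` with their defining hypotheses), and the per-curve
COMPUTED claims `hordL`, `hcert`, `hs`/`hv` — where `hcert` is now stated for every datum satisfying
the pinning predicate, i.e. (by `IsSplitMultCanonical.unique` / `IsMultCanonical.unique`, PROVED)
for THE Stein–Wuthrich regulator, one `p`-adic number per curve.

* `X11.bsdp_of_thmA_{split,nonsplit}_of_certificate` — X11 ∧ ram, `p ≥ 3` (Skinner 2016 Thm. A).
* `X11.bsdp_of_katoSurj_{split,nonsplit}_of_surjective_pow_of_certificate` — X11, odd `p`,
  `p`-adically surjective image (Kato via Wuthrich 2014 Thm. 3 / Cor. 19; at `p ≥ 5` from `Surj W p`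
  by `serre_hasSurjectiveModNGaloisRep_pow_holds`, at `p = 3` via Lemma 20).
* `X2.bsdp_of_thm16mult_{split,nonsplit}_of_certificate` — X2 (Wuthrich 2014 Thm. 16).

References: Stein–Wuthrich 2013 Thm. 6.1, §4.2 [SteinWuthrich2013]; Werner 1998 Thm. 6.1/6.2,
Cor. 7.3 [Werner1998]; Skinner 2016 Thm. A [Skinner2016PacificMC]; Wuthrich 2014 Thm. 3, Thm. 16,
Cor. 19, Prop. 21 [Wuthrich2014]; Miller 2011 Prop. 7.6 [Miller2011LMS].
-/

set_option autoImplicit false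

noncomputable section

open scoped Classical MatrixGroups ModularForm

open CongruenceSubgroup WeierstrassCurve Literature.NumberTheory.EllipticCurves
  Literature.NumberTheory.EllipticCurves.ModularForms
  Literature.NumberTheory.EllipticCurves.Rank1Residual
  Literature.NumberTheory.EllipticCurves.Skinner2016
  Literature.NumberTheory.EllipticCurves.Wuthrich2014
  Literature.NumberTheory.EllipticCurves.SteinWuthrich2013

namespace Literature.NumberTheory.EllipticCurves.Rank1Residual.Typed

/-! ### X11 ∧ ram (Skinner 2016 Thm. A) -/

/-- **X11 ∧ ram, split multiplicative `p ≥ 3`, analytic rank `≤ 1`, `p ∤ #Ш_an`: `BSD(E,p)` from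
PUBLISHED facts (Skinner Thm. A `hA`, SW Thm. 6.1 `hJ`, SW §4.2 height existence `hH`, Wuthrich
Prop. 21 `hW`, GZK, modularity, BDGP `h𝓛`) plus the per-curve COMPUTED claims `hordL`, `hcert`
(for THE Stein–Wuthrich height: every `Dh` with `IsSplitMultCanonical Dh Dq`, unique), `hs`/`hv`.**
`X11.bsdp_of_thmA_split_of_canonical_certificate` with `(Dh, hDh)` supplied by
`exists_isSplitMultCanonical`. Per curve; NOT a deletion of X11. [cite: SteinWuthrich2013, Thm. 6.1 (p. 20) and §4.2]
[cite: Skinner2016PacificMC, Thm. A] [cite: Miller2011LMS, Prop. 7.6] -/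
theorem X11.bsdp_of_thmA_split_of_certificate (hA : thmA_charIdeal_multiplicative)
    (hJ : thm61_splitMultiplicative) (hH : exists_isSplitMultCanonical)
    (hW : Wuthrich2014.sha_dvd_analyticSha)
    (hGZK : rank_eq_analyticRank_of_analyticRank_le_one) (hmod : hasEntireLFunction_rat)
    (W : WeierstrassCurve ℚ) [W.IsElliptic] [W.IsGloballyMinimal] (p : ℕ) [Fact p.Prime]
    (h𝓛 : LInvariant_ne_zero (W := W) (p := p))
    {κ : ZpExtension ℚ p} {γ : Field.absoluteGaloisGroup ℚ} {N : ℕ} [NeZero N]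
    {f : CuspForm (Gamma0 N) 2} (hp : 3 ≤ p) (hr : W.analyticRank ≤ 1) (hX : ClassX11 W p)
    (hram : Ram W p) (Dq : TateParameterData W p)
    (hκ : κ.IsCyclotomic) (hγ : κ.IsTopGenerator γ) (hγ' : IsCyclotomicVariable p γ)
    (hf : IsNewformOf W f) (D : W.SelmerDualData κ γ) (ϖ : ℚ) (hϖ0 : ϖ ≠ 0)
    (hϖ : (ϖ : ℝ) * W.realPeriodRat = plusPeriod f)
    (L : PowerSeries ℚ_[p]) (hL : IsSplitMultPAdicLFunctionOf f p L)
    (hordL : L.order = (W.mordellWeilRank + 1 : ℕ))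
    (hcert : ∀ Dh : PAdicHeightData W p, IsSplitMultCanonical Dh Dq →
      (((ϖ : ℚ) : ℚ_[p]) * PowerSeries.coeff (W.mordellWeilRank + 1) L *
          (padicLog p (cyclotomicGenerator p) ^ (W.mordellWeilRank + 1) *
            (W.torsionOrder : ℚ_[p]) ^ 2)).valuation =
        (LInvariant Dq * (W.tamagawaProduct : ℚ_[p]) * padicRegulator Dh).valuation)
    {s : ℚ} (hs : shaAn W = (s : ℂ)) (hv : padicValRat p s = 0) : BSDp W p := by
  obtain ⟨Dh, hDh⟩ := hH W p (by omega) Dq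
  exact X11.bsdp_of_thmA_split_of_canonical_certificate hA hJ hW hGZK hmod W p h𝓛 hp hr hX hram Dq Dh
    hDh hκ hγ hγ' hf D ϖ hϖ0 hϖ L hL hordL (hcert Dh hDh) hs hv

/-- **X11 ∧ ram, NON-split multiplicative `p ≥ 3`**: the same with `e = 0`, `A = 2 ∏ c_v`,
`B = log_p(γ_cyc)^r #E(ℚ)_tors²`, `IsMultCanonical Dh q`, and `(Dh, hDh)` supplied by
`exists_isMultCanonical`. [cite: SteinWuthrich2013, Thm. 6.1 (p. 20) and §4.2]
[cite: Skinner2016PacificMC, Thm. A] [cite: Miller2011LMS, Prop. 7.6] -/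
theorem X11.bsdp_of_thmA_nonsplit_of_certificate (hA : thmA_charIdeal_multiplicative)
    (hJ : thm61_nonsplitMultiplicative) (hH : exists_isMultCanonical)
    (hW : Wuthrich2014.sha_dvd_analyticSha)
    (hGZK : rank_eq_analyticRank_of_analyticRank_le_one) (hmod : hasEntireLFunction_rat)
    (W : WeierstrassCurve ℚ) [W.IsElliptic] [W.IsGloballyMinimal] (p : ℕ) [Fact p.Prime]
    {κ : ZpExtension ℚ p} {γ : Field.absoluteGaloisGroup ℚ} {N : ℕ} [NeZero N]
    {f : CuspForm (Gamma0 N) 2} (hp : 3 ≤ p) (hr : W.analyticRank ≤ 1) (hX : ClassX11 W p)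
    (hram : Ram W p) (hns : ¬ W.HasSplitMultiplicativeReductionAtPrime p)
    {q : ℚ_[p]} (hq0 : q ≠ 0) (hq1 : ‖q‖ < 1) (hqj : tateJ q = (W.j : ℚ_[p]))
    (hκ : κ.IsCyclotomic) (hγ : κ.IsTopGenerator γ) (hγ' : IsCyclotomicVariable p γ)
    (hf : IsNewformOf W f) (D : W.SelmerDualData κ γ) (ϖ : ℚ) (hϖ0 : ϖ ≠ 0)
    (hϖ : (ϖ : ℝ) * W.realPeriodRat = plusPeriod f)
    (L : PowerSeries ℚ_[p]) (hL : IsMultPAdicLFunctionOf f p (-1) L)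
    (hordL : L.order = (W.mordellWeilRank : ℕ))
    (hcert : ∀ Dh : PAdicHeightData W p, IsMultCanonical Dh q →
      (((ϖ : ℚ) : ℚ_[p]) * PowerSeries.coeff W.mordellWeilRank L *
          (padicLog p (cyclotomicGenerator p) ^ W.mordellWeilRank *
            (W.torsionOrder : ℚ_[p]) ^ 2)).valuation =
        (2 * (W.tamagawaProduct : ℚ_[p]) * padicRegulator Dh).valuation)
    {s : ℚ} (hs : shaAn W = (s : ℂ)) (hv : padicValRat p s = 0) : BSDp W p := by
  obtain ⟨Dh, hDh⟩ := hH W p (by omega) hX.1 hns q hq0 hq1 hqj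
  exact X11.bsdp_of_thmA_nonsplit_of_canonical_certificate hA hJ hW hGZK hmod W p hp hr hX hram hns
    hq0 hq1 hqj Dh hDh hκ hγ hγ' hf D ϖ hϖ0 hϖ L hL hordL (hcert Dh hDh) hs hv

/-! ### X11, `p`-adically surjective image (Kato / Wuthrich 2014 Thm. 3, Cor. 19) -/

/-- **X11, split multiplicative odd `p`, `ρ_{E,p^∞}` surjective, analytic rank `≤ 1`,
`p ∤ #Ш_an`**: `X11.bsdp_of_katoSurj_split_of_surjective_pow_of_canonical_certificate` with
`(Dh, hDh)` supplied by `exists_isSplitMultCanonical`; `hcert` for THE Stein–Wuthrich height.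
Per curve. [cite: SteinWuthrich2013, Thm. 6.1 (p. 20) and §4.2]
[cite: Wuthrich2014, Thm. 3 (p. 383) and Cor. 19 (p. 398)] [cite: Miller2011LMS, Prop. 7.6] -/
theorem X11.bsdp_of_katoSurj_split_of_surjective_pow_of_certificate
    (hK : kato_charIdeal_dvd_multiplicative_of_surjective) (hJ : thm61_splitMultiplicative)
    (hH : exists_isSplitMultCanonical) (hW : Wuthrich2014.sha_dvd_analyticSha)
    (hGZK : rank_eq_analyticRank_of_analyticRank_le_one) (hmod : hasEntireLFunction_rat)
    (W : WeierstrassCurve ℚ) [W.IsElliptic] [W.IsGloballyMinimal] (p : ℕ) [Fact p.Prime]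
    (h𝓛 : LInvariant_ne_zero (W := W) (p := p))
    {κ : ZpExtension ℚ p} {γ : Field.absoluteGaloisGroup ℚ} {N : ℕ} [NeZero N]
    {f : CuspForm (Gamma0 N) 2} (hp : p ≠ 2) (hr : W.analyticRank ≤ 1) (hX : ClassX11 W p)
    (hρ : ∀ n : ℕ, W.HasSurjectiveModNGaloisRep (p ^ n : ℕ)) (Dq : TateParameterData W p)
    (hκ : κ.IsCyclotomic) (hγ : κ.IsTopGenerator γ) (hγ' : IsCyclotomicVariable p γ)
    (hf : IsNewformOf W f) (D : W.SelmerDualData κ γ) (ϖ : ℚ) (hϖ0 : ϖ ≠ 0)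
    (hϖ : (ϖ : ℝ) * W.realPeriodRat = plusPeriod f)
    (L : PowerSeries ℚ_[p]) (hL : IsSplitMultPAdicLFunctionOf f p L)
    (hordL : L.order = (W.mordellWeilRank + 1 : ℕ))
    (hcert : ∀ Dh : PAdicHeightData W p, IsSplitMultCanonical Dh Dq →
      (((ϖ : ℚ) : ℚ_[p]) * PowerSeries.coeff (W.mordellWeilRank + 1) L *
          (padicLog p (cyclotomicGenerator p) ^ (W.mordellWeilRank + 1) *
            (W.torsionOrder : ℚ_[p]) ^ 2)).valuation =
        (LInvariant Dq * (W.tamagawaProduct : ℚ_[p]) * padicRegulator Dh).valuation)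
    {s : ℚ} (hs : shaAn W = (s : ℂ)) (hv : padicValRat p s = 0) : BSDp W p := by
  obtain ⟨Dh, hDh⟩ := hH W p hp Dq
  exact X11.bsdp_of_katoSurj_split_of_surjective_pow_of_canonical_certificate hK hJ hW hGZK hmod W p
    h𝓛 hp hr hX hρ Dq Dh hDh hκ hγ hγ' hf D ϖ hϖ0 hϖ L hL hordL (hcert Dh hDh) hs hv

/-- **X11, NON-split multiplicative odd `p`, `ρ_{E,p^∞}` surjective**:
`X11.bsdp_of_katoSurj_nonsplit_of_surjective_pow_of_canonical_certificate` with `(Dh, hDh)`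
supplied by `exists_isMultCanonical`. Per curve. [cite: SteinWuthrich2013, Thm. 6.1 (p. 20) and §4.2]
[cite: Wuthrich2014, Thm. 3 (p. 383) and Cor. 19 (p. 398)] [cite: Miller2011LMS, Prop. 7.6] -/
theorem X11.bsdp_of_katoSurj_nonsplit_of_surjective_pow_of_certificate
    (hK : kato_charIdeal_dvd_multiplicative_of_surjective) (hJ : thm61_nonsplitMultiplicative)
    (hH : exists_isMultCanonical) (hW : Wuthrich2014.sha_dvd_analyticSha)
    (hGZK : rank_eq_analyticRank_of_analyticRank_le_one) (hmod : hasEntireLFunction_rat)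
    (W : WeierstrassCurve ℚ) [W.IsElliptic] [W.IsGloballyMinimal] (p : ℕ) [Fact p.Prime]
    {κ : ZpExtension ℚ p} {γ : Field.absoluteGaloisGroup ℚ} {N : ℕ} [NeZero N]
    {f : CuspForm (Gamma0 N) 2} (hp : p ≠ 2) (hr : W.analyticRank ≤ 1) (hX : ClassX11 W p)
    (hρ : ∀ n : ℕ, W.HasSurjectiveModNGaloisRep (p ^ n : ℕ))
    (hns : ¬ W.HasSplitMultiplicativeReductionAtPrime p)
    {q : ℚ_[p]} (hq0 : q ≠ 0) (hq1 : ‖q‖ < 1) (hqj : tateJ q = (W.j : ℚ_[p]))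
    (hκ : κ.IsCyclotomic) (hγ : κ.IsTopGenerator γ) (hγ' : IsCyclotomicVariable p γ)
    (hf : IsNewformOf W f) (D : W.SelmerDualData κ γ) (ϖ : ℚ) (hϖ0 : ϖ ≠ 0)
    (hϖ : (ϖ : ℝ) * W.realPeriodRat = plusPeriod f)
    (L : PowerSeries ℚ_[p]) (hL : IsMultPAdicLFunctionOf f p (-1) L)
    (hordL : L.order = (W.mordellWeilRank : ℕ))
    (hcert : ∀ Dh : PAdicHeightData W p, IsMultCanonical Dh q →
      (((ϖ : ℚ) : ℚ_[p]) * PowerSeries.coeff W.mordellWeilRank L *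
          (padicLog p (cyclotomicGenerator p) ^ W.mordellWeilRank *
            (W.torsionOrder : ℚ_[p]) ^ 2)).valuation =
        (2 * (W.tamagawaProduct : ℚ_[p]) * padicRegulator Dh).valuation)
    {s : ℚ} (hs : shaAn W = (s : ℂ)) (hv : padicValRat p s = 0) : BSDp W p := by
  obtain ⟨Dh, hDh⟩ := hH W p hp hX.1 hns q hq0 hq1 hqj
  exact X11.bsdp_of_katoSurj_nonsplit_of_surjective_pow_of_canonical_certificate hK hJ hW hGZK hmod
    W p hp hr hX hρ hns hq0 hq1 hqj Dh hDh hκ hγ hγ' hf D ϖ hϖ0 hϖ L hL hordL (hcert Dh hDh) hs hv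

/-! ### X2 (Wuthrich 2014 Thm. 16) -/

/-- **X2, split multiplicative odd `p`, analytic rank `≤ 1`, `p ∤ #Ш_an`**:
`X2.bsdp_of_thm16mult_split_of_canonical_certificate` with `(Dh, hDh)` supplied by
`exists_isSplitMultCanonical`; `hcert` for THE Stein–Wuthrich height. Per curve; X2 stays
CONSTRUCTION-SHAPED. [cite: SteinWuthrich2013, Thm. 6.1 (p. 20) and §4.2]
[cite: Wuthrich2014, Thm. 16 (p. 397)] [cite: Miller2011LMS, Prop. 7.6] -/
theorem X2.bsdp_of_thm16mult_split_of_certificate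
    (h16 : thm16_charIdeal_dvd_multiplicative_of_reducible) (hJ : thm61_splitMultiplicative)
    (hH : exists_isSplitMultCanonical) (hGZK : rank_eq_analyticRank_of_analyticRank_le_one)
    (W : WeierstrassCurve ℚ) [W.IsElliptic] [W.IsGloballyMinimal] (p : ℕ) [Fact p.Prime]
    (h𝓛 : LInvariant_ne_zero (W := W) (p := p))
    {κ : ZpExtension ℚ p} {γ : Field.absoluteGaloisGroup ℚ} {N : ℕ} [NeZero N]
    {f : CuspForm (Gamma0 N) 2} (hr : W.analyticRank ≤ 1) (hX : ClassX2 W p)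
    (Dq : TateParameterData W p)
    (hκ : κ.IsCyclotomic) (hγ : κ.IsTopGenerator γ) (hγ' : IsCyclotomicVariable p γ)
    (hf : IsNewformOf W f) (D : W.SelmerDualData κ γ) (ϖ : ℚ) (hϖ0 : ϖ ≠ 0)
    (hϖ : (ϖ : ℝ) * W.realPeriodRat = plusPeriod f)
    (L : PowerSeries ℚ_[p]) (hL : IsSplitMultPAdicLFunctionOf f p L)
    (hordL : L.order = (W.mordellWeilRank + 1 : ℕ))
    (hcert : ∀ Dh : PAdicHeightData W p, IsSplitMultCanonical Dh Dq →
      (((ϖ : ℚ) : ℚ_[p]) * PowerSeries.coeff (W.mordellWeilRank + 1) L *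
          (padicLog p (cyclotomicGenerator p) ^ (W.mordellWeilRank + 1) *
            (W.torsionOrder : ℚ_[p]) ^ 2)).valuation =
        (LInvariant Dq * (W.tamagawaProduct : ℚ_[p]) * padicRegulator Dh).valuation)
    {s : ℚ} (hs : shaAn W = (s : ℂ)) (hv : padicValRat p s = 0) : BSDp W p := by
  obtain ⟨Dh, hDh⟩ := hH W p hX.1 Dq
  exact X2.bsdp_of_thm16mult_split_of_canonical_certificate h16 hJ hGZK W p h𝓛 hr hX Dq Dh hDh hκ hγ
    hγ' hf D ϖ hϖ0 hϖ L hL hordL (hcert Dh hDh) hs hv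

/-- **X2, NON-split multiplicative odd `p`**: `X2.bsdp_of_thm16mult_nonsplit_of_canonical_certificate`
with `(Dh, hDh)` supplied by `exists_isMultCanonical`. Per curve; X2 stays CONSTRUCTION-SHAPED.
[cite: SteinWuthrich2013, Thm. 6.1 (p. 20) and §4.2] [cite: Wuthrich2014, Thm. 16 (p. 397)]
[cite: Miller2011LMS, Prop. 7.6] -/
theorem X2.bsdp_of_thm16mult_nonsplit_of_certificate
    (h16 : thm16_charIdeal_dvd_multiplicative_of_reducible) (hJ : thm61_nonsplitMultiplicative)
    (hH : exists_isMultCanonical) (hGZK : rank_eq_analyticRank_of_analyticRank_le_one)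
    (W : WeierstrassCurve ℚ) [W.IsElliptic] [W.IsGloballyMinimal] (p : ℕ) [Fact p.Prime]
    {κ : ZpExtension ℚ p} {γ : Field.absoluteGaloisGroup ℚ} {N : ℕ} [NeZero N]
    {f : CuspForm (Gamma0 N) 2} (hr : W.analyticRank ≤ 1) (hX : ClassX2 W p)
    (hns : ¬ W.HasSplitMultiplicativeReductionAtPrime p)
    {q : ℚ_[p]} (hq0 : q ≠ 0) (hq1 : ‖q‖ < 1) (hqj : tateJ q = (W.j : ℚ_[p]))
    (hκ : κ.IsCyclotomic) (hγ : κ.IsTopGenerator γ) (hγ' : IsCyclotomicVariable p γ)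
    (hf : IsNewformOf W f) (D : W.SelmerDualData κ γ) (ϖ : ℚ) (hϖ0 : ϖ ≠ 0)
    (hϖ : (ϖ : ℝ) * W.realPeriodRat = plusPeriod f)
    (L : PowerSeries ℚ_[p]) (hL : IsMultPAdicLFunctionOf f p (-1) L)
    (hordL : L.order = (W.mordellWeilRank : ℕ))
    (hcert : ∀ Dh : PAdicHeightData W p, IsMultCanonical Dh q →
      (((ϖ : ℚ) : ℚ_[p]) * PowerSeries.coeff W.mordellWeilRank L *
          (padicLog p (cyclotomicGenerator p) ^ W.mordellWeilRank *
            (W.torsionOrder : ℚ_[p]) ^ 2)).valuation =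
        (2 * (W.tamagawaProduct : ℚ_[p]) * padicRegulator Dh).valuation)
    {s : ℚ} (hs : shaAn W = (s : ℂ)) (hv : padicValRat p s = 0) : BSDp W p := by
  obtain ⟨Dh, hDh⟩ := hH W p hX.1 hX.2.2 hns q hq0 hq1 hqj
  exact X2.bsdp_of_thm16mult_nonsplit_of_canonical_certificate h16 hJ hGZK W p hr hX hns hq0 hq1 hqj
    Dh hDh hκ hγ hγ' hf D ϖ hϖ0 hϖ L hL hordL (hcert Dh hDh) hs hv

end Literature.NumberTheory.EllipticCurves.Rank1Residual.Typed

end
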